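/-
Origin: expansion seat `prover-pub-hodgecm-mc-carch-1-g35-0`, handover #CA61 2026-08-20T22:51Z md5 6e70f085d9f5 (326 l.; NEW additive leaf; imports Model.ArchKTypeOfDefiniteChar + Model.ArchKTypeOfSlotRec; ns HodgeCM.Model; 6 theorems; NAMES for audit: HodgeCM.Model.harch_zero_of_defType_tmulG · HodgeCM.Model.harch_one_of_defType_tmulG · HodgeCM.Model.harm_lineOmega_zeroG) (`HOME/mc/pub-hodgecm-mc-carch-1/stage66/HodgeCM/Model/ArchKTypeOfDist.lean`, md5 6e70f085d9f5, 326 lines);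
landed by the second packager p2 gen 15 (p2-g15) in gate run 66 as `HodgeCM/Model/ArchKTypeOfDist.lean` (verbatim).
-/
/-
Copyright (c) 2026. Released under Apache 2.0 license as described in the file LICENSE.
Cell pub-hodgecm, MODEL layer (construction prover mc-carch-1, gen 35), row-9 (J-Liu-Θ) junction, (J4) distribution input —
the ARCHIMEDEAN HALF of sinst-1's `ThetaAdelicSide.ThetaDistDatum` (`Model/AdelicThetaDistribution.lean` #1246, fields `ωA/hA/Φarch/harm/hdef`)
over the generic honest line representations `lineRepOf … k`, k = 0, 1 (sinst-1-g10 REQUEST 2026-08-20T22:41Z (a1)–(a3)).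
-/
import Summits.HodgeConjecture.HodgeCM.Model.ArchKTypeOfDefiniteChar
import Summits.HodgeConjecture.HodgeCM.Model.ArchKTypeOfSlotRec_2

/-!
# (c5) at the operator level for every finite vector, and the `K_∞`-harmonicity of the honest family, BY NAME

For the honest S-side line representation `lineRepOf V S hGR hGR₀ hGR₁ hGR₂ hGR₃ η₀ η₁ η₂ η₃ k` (LAYER B `Model/ArchSideTerm`), lines
`k = 0, 1`, the archimedean half of the (J4) product Weil datum consists of

* (a1) the `ι₁`-archimedean factor `ωA_k = lineOmega_k` with `lineRepOf k (archInfOf V u, 1) = ωA_k u ⊗ 1` — ALREADY BY NAME: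
  `lineOmega_zero/one` + `lineRepOf_zero/one_archInfOf_eq` (`Model/ArchKTypeOfOmega`), nothing added here;
* (a2) the harmonic family `Φ_∞,k(ℓ) = blockFamilyOfAt … (lineVec (dW S k)) … eR eS (degOnePDual Empty) Φ₂ ℓ` (#CA13) and its
  `Stab(x₀)`-equivariance of type `τ₁^∨` under `ωA_k` — § 2 **`harm_lineOmega_zero/oneG`**: #CA13 `smulPull_blockFamilyOfAt_harm` with its
  frame-matching input `hsec` discharged by `hsec_of_embedding_eq` (canonical representative `hemb : (mk ι₁).embedding = ι₁`), its
  `(K)`-input by #CA14 `cmBlockRepAt_κ_tensorPi_lineVacExponentsZero/One` (at the vacuum exponent tuple OF RECORD, sign facts `h₁W`) and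
  `hΦ₁ := unitaryOpPi_dualPairι_degOnePDual Empty`; the ONE remaining hypothesis is the character identity (χ)_k `hχ` (pin: sinst-1's
  `SInstance.hχ_zero/one_ROGTC`);
* (a3) **(c5) AT THE OPERATOR LEVEL, FOR EVERY FINITE VECTOR** — § 1: the archimedean core
  **`smul_cmArchWeilRep_blockFamilyOfAt_eq_self_zero/oneG`**: for `a ∈ U(V.Hm)(L ⊗ ℝ)` trivial at `w(ι₁)`,
  `c_k(a′) • ω_∞,k(a′, 1) Φ_∞,k(ℓ) = Φ_∞,k(ℓ)` (`a′ = archFrameCongr … a`; the place induction `smul_apply_eq_self_of_places` of #CA20 under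
  EXACTLY the hypotheses `hω` (exponent table, pin: #CA33 `defExponentZero/One_spec`) and `hdef` (definite type of the line scalar, pin:
  `SInstance.hdef_zero/one_ROGTC`) of #CA27 `harch_zero/one_of_defTypeG` — the `have` inside its proof, promoted), whence
  **`harch_zero/one_of_defType_tmulG`**: `lineRepOf k ((a)^𝔸_regime, 1) (Φ_∞,k(ℓ) ⊗ Φ_f) = Φ_∞,k(ℓ) ⊗ Φ_f` for EVERY `ℓ` and EVERY
  `Φ_f ∈ 𝒮((𝔸_{L⁺}^∞)³)` (#CA27 `lineRepOf_zero/one_regime_archToAdelicG` + tree `adelicTensorEnd_apply_tmul`) — #CA27's `harch` with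
  `testFun (Φ ℓ) x₀ N` replaced by the pure tensor, i.e. sinst-1's `hdef` field VERBATIM at `lineRepOf`.

At `S := archSideOf V c …` everything applies by `archSideOf_P_ω` (`rfl`); at the guarded pins by the same sockets glue-1's `…STR2D` fills.
Nothing is cited and nothing is minted: kernel lemmas over installed carch modules; 0 records, 0 `def … : Prop`.
-/

set_option autoImplicit false

noncomputable section

open NumberField NumberField.InfinitePlace NumberField.mixedEmbedding IsDedekindDomain
open scoped Matrix TensorProduct Classical SchwartzMap
open MvPolynomial
open MulAction
open Literature.Geometry.ComplexHyperbolic.BallModel (U21 x₀ stabilizerEquivK21)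
open Literature.NumberTheory.Automorphic.U21 (K21 matA sclD)
open Literature.AlgebraicGeometry.HodgeTheory
open Literature.AlgebraicGeometry.ShimuraVarieties Literature.AlgebraicGeometry.ShimuraVarieties.BallForms
open Literature.NumberTheory.Automorphic Literature.NumberTheory.Automorphic.UnitaryGroup Literature.NumberTheory.Weil1964
open Literature.RepresentationTheory.KonnoKonno2007 Literature.RepresentationTheory.KonnoKonno2007.RealDualPair
open Literature.NumberTheory.GelbartRogawski1991 Literature.NumberTheory.GelbartRogawski1991.UnitaryDualPair
open Literature.RepresentationTheory (atPlace)
open Literature.Analysis.SegalBargmann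
open HodgeCM.Adelic HodgeCM.PerL34 HodgeCM.Model.HypCensus HodgeCM.Model.SupplyInstance HodgeCM.Model.ArchSideTerm

namespace HodgeCM.Model

/-! ### § 1. (c5) at the operator level: the archimedean core and the pure-tensor form -/

section DefTypeTmul

variable {L : CMField} {ι₁ : L →+* ℂ} (V : HermSpace3 L ι₁) (S : StubTree.SeesawDatum L)
variable
  (hGR : (cmSplittingDatum (L : Type) finProdFinEquiv (frameD V) (frameD_real V) (frameD_ne V) (dW S) (dW_real S) (dW_ne S)).CompatibleSplitting)
  (hGR₀ : (cmSplittingDatum (L : Type) (e₁) (frameD V) (frameD_real V) (frameD_ne V) (lineVec (L : Type) (dW S 0))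
    (fun _ => dW_real S 0) (fun _ => dW_ne S 0)).CompatibleSplitting)
  (hGR₁ : (cmSplittingDatum (L : Type) (e₁) (frameD V) (frameD_real V) (frameD_ne V) (lineVec (L : Type) (dW S 1))
    (fun _ => dW_real S 1) (fun _ => dW_ne S 1)).CompatibleSplitting)
  (hGR₂ : (cmSplittingDatum (L : Type) (e₁) (frameD V) (frameD_real V) (frameD_ne V) (lineVec (L : Type) (dW' S 0))
    (fun _ => dW'_real S 0) (fun _ => dW'_ne S 0)).CompatibleSplitting)
  (hGR₃ : (cmSplittingDatum (L : Type) (e₁) (frameD V) (frameD_real V) (frameD_ne V) (lineVec (L : Type) (dW' S 1))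
    (fun _ => dW'_real S 1) (fun _ => dW'_ne S 1)).CompatibleSplitting)
  (η₀ η₁ η₂ η₃ : CMAdelic (L : Type) (frameD V) × CMAdelicOne (L : Type) →* ℂˣ)
  (hV : IsAnisotropic L V.Hm)

variable {S' : Type} [Fintype S'] [DecidableEq S']
  (eR : PosIdx (cmXW (L : Type) (frameD V) (lineVec (L : Type) (dW S 0)) (fun _ => dW_real S 0) ι₁ (HypCensus.cmPlace (L : Type) ι₁)) ≃ Unit)
  (eS : NegIdx (cmXW (L : Type) (frameD V) (lineVec (L : Type) (dW S 0)) (fun _ => dW_real S 0) ι₁ (HypCensus.cmPlace (L : Type) ι₁)) ≃ S')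
  (eR₁ : PosIdx (cmXW (L : Type) (frameD V) (lineVec (L : Type) (dW S 1)) (fun _ => dW_real S 1) ι₁ (HypCensus.cmPlace (L : Type) ι₁)) ≃ Unit)
  (eS₁ : NegIdx (cmXW (L : Type) (frameD V) (lineVec (L : Type) (dW S 1)) (fun _ => dW_real S 1) ι₁ (HypCensus.cmPlace (L : Type) ι₁)) ≃ S')

/-- **(c5) for line 0, ARCHIMEDEAN CORE**: an archimedean `a ∈ U(V.Hm)(L ⊗ ℝ)` trivial at `w(ι₁)` fixes every member of the line's slot family
under `c₀(a′) • ω_∞,0(a′, 1)` — from the exponent table `hω` and the definite type `hdef` of the line scalar (#CA27's hypotheses, verbatim). -/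
theorem smul_cmArchWeilRep_blockFamilyOfAt_eq_self_zeroG
    (a : {v : InfinitePlace ↥(maximalRealSubfield L) // v.IsReal} → ℤ)
    (hω : ∀ b : {v : InfinitePlace ↥(maximalRealSubfield L) // v.IsReal}, b ≠ HypCensus.cmPlace (L : Type) ι₁ →
      ∀ (u : UnitaryGroup.archLocal (L : Type) 3 (Matrix.diagonal (frameD V)) (cmPlaceOver (L : Type) b)) (ℓ : Module.Dual ℂ (Fin 2 → ℂ)),
        cmArchWeilRep (L : Type) e₁ (frameD V) (frameD_real V) (frameD_ne V) (lineVec (L : Type) (dW S 0)) (fun _ => dW_real S 0)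
            (fun _ => dW_ne S 0) hGR₀
            (UnitaryGroup.archSingle (↥(maximalRealSubfield L)) L (IsCMField.complexConj L) 3 (Matrix.diagonal (frameD V))
              (IsCMField.complexConj_ne_one L) (NumberField.complexConj_smul_infinitePlace (L : Type)) (cmPlaceOver (L : Type) b) u, 1)
            (blockFamilyOfAt (L : Type) e₁ (frameD V) (frameD_real V) (frameD_ne V) (lineVec (L : Type) (dW S 0)) (fun _ => dW_real S 0)
              (fun _ => dW_ne S 0) ι₁ (blockPosEquiv V) (blockNegEquiv V) eR eS (degOnePDual S') (binvPi 1) ℓ) =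
          (((u : UnitaryGroup.archLocal (L : Type) 3 (Matrix.diagonal (frameD V)) (cmPlaceOver (L : Type) b)) : GL (Fin 3) ℂ) :
              Matrix (Fin 3) (Fin 3) ℂ).det ^ a b •
            blockFamilyOfAt (L : Type) e₁ (frameD V) (frameD_real V) (frameD_ne V) (lineVec (L : Type) (dW S 0)) (fun _ => dW_real S 0)
              (fun _ => dW_ne S 0) ι₁ (blockPosEquiv V) (blockNegEquiv V) eR eS (degOnePDual S') (binvPi 1) ℓ)
    (hdef : ∀ b : {v : InfinitePlace ↥(maximalRealSubfield L) // v.IsReal}, b ≠ HypCensus.cmPlace (L : Type) ι₁ →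
      ∀ u : UnitaryGroup.archLocal (L : Type) 3 (Matrix.diagonal (frameD V)) (cmPlaceOver (L : Type) b),
        ((archScalar_zeroG V S hGR hGR₀ hGR₁ η₀
            (UnitaryGroup.archSingle (↥(maximalRealSubfield L)) L (IsCMField.complexConj L) 3 (Matrix.diagonal (frameD V))
              (IsCMField.complexConj_ne_one L) (NumberField.complexConj_smul_infinitePlace (L : Type)) (cmPlaceOver (L : Type) b) u) : ℂˣ) : ℂ) *
          (((u : UnitaryGroup.archLocal (L : Type) 3 (Matrix.diagonal (frameD V)) (cmPlaceOver (L : Type) b)) : GL (Fin 3) ℂ) :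
              Matrix (Fin 3) (Fin 3) ℂ).det ^ a b = 1) :
    ∀ aa : UnitaryGroup.arch (↥(maximalRealSubfield L)) L (IsCMField.complexConj L) 3 V.Hm,
      UnitaryGroup.archAt (↥(maximalRealSubfield L)) L (IsCMField.complexConj L) 3 V.Hm (UnitaryGroup.cmPlace (L : Type) ι₁)
          (NumberField.complexConj_smul_infinitePlace (L : Type) _) (IsCMField.complexConj_ne_one (L : Type)) aa = 1 →
      ∀ ℓ : Module.Dual ℂ (Fin 2 → ℂ),
        ((archScalar_zeroG V S hGR hGR₀ hGR₁ η₀ (archFrameCongr (L : Type) V.Hm (frameG V) (frameD V) (frame_congr V) aa) : ℂˣ) : ℂ) •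
            cmArchWeilRep (L : Type) e₁ (frameD V) (frameD_real V) (frameD_ne V) (lineVec (L : Type) (dW S 0)) (fun _ => dW_real S 0)
              (fun _ => dW_ne S 0) hGR₀ (archFrameCongr (L : Type) V.Hm (frameG V) (frameD V) (frame_congr V) aa, 1)
              (blockFamilyOfAt (L : Type) e₁ (frameD V) (frameD_real V) (frameD_ne V) (lineVec (L : Type) (dW S 0)) (fun _ => dW_real S 0)
              (fun _ => dW_ne S 0) ι₁ (blockPosEquiv V) (blockNegEquiv V) eR eS (degOnePDual S') (binvPi 1) ℓ) =
          blockFamilyOfAt (L : Type) e₁ (frameD V) (frameD_real V) (frameD_ne V) (lineVec (L : Type) (dW S 0)) (fun _ => dW_real S 0)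
              (fun _ => dW_ne S 0) ι₁ (blockPosEquiv V) (blockNegEquiv V) eR eS (degOnePDual S') (binvPi 1) ℓ := by
  intro aa haa ℓ
  have h := smul_apply_eq_self_of_places (L : Type) (Matrix.diagonal (frameD V))
    ((cmArchWeilRep (L : Type) e₁ (frameD V) (frameD_real V) (frameD_ne V) (lineVec (L : Type) (dW S 0)) (fun _ => dW_real S 0)
      (fun _ => dW_ne S 0) hGR₀).comp (MonoidHom.inl _ _))
    (archScalar_zeroG V S hGR hGR₀ hGR₁ η₀)
    (blockFamilyOfAt (L : Type) e₁ (frameD V) (frameD_real V) (frameD_ne V) (lineVec (L : Type) (dW S 0)) (fun _ => dW_real S 0)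
      (fun _ => dW_ne S 0) ι₁ (blockPosEquiv V) (blockNegEquiv V) eR eS (degOnePDual S') (binvPi 1) ℓ)
    (UnitaryGroup.cmPlace (L : Type) ι₁) (fun b hb u => by
      rw [MonoidHom.comp_apply, MonoidHom.inl_apply, hω b (ne_cmPlace_of_cmPlaceOver_ne hb) u ℓ, smul_smul,
        hdef b (ne_cmPlace_of_cmPlaceOver_ne hb) u, one_smul])
    (archFrameCongr (L : Type) V.Hm (frameG V) (frameD V) (frame_congr V) aa) (archAt_archFrameCongr_eq_one V haa)
  rw [MonoidHom.comp_apply, MonoidHom.inl_apply] at h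
  exact h

/-- **(c5) for line 0 AT THE OPERATOR LEVEL, FOR EVERY FINITE VECTOR**: `lineRepOf 0 ((a)^𝔸_regime, 1) (Φ_∞,0(ℓ) ⊗ Φ_f) = Φ_∞,0(ℓ) ⊗ Φ_f`
— sinst-1's `ThetaDistDatum.hdef` for slot 0 at `lineRepOf` (#CA27 `harch_zero_of_defTypeG` with `testFun (Φ ℓ) x₀ N` replaced by the pure tensor). -/
theorem harch_zero_of_defType_tmulG
    (a : {v : InfinitePlace ↥(maximalRealSubfield L) // v.IsReal} → ℤ)
    (hω : ∀ b : {v : InfinitePlace ↥(maximalRealSubfield L) // v.IsReal}, b ≠ HypCensus.cmPlace (L : Type) ι₁ →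
      ∀ (u : UnitaryGroup.archLocal (L : Type) 3 (Matrix.diagonal (frameD V)) (cmPlaceOver (L : Type) b)) (ℓ : Module.Dual ℂ (Fin 2 → ℂ)),
        cmArchWeilRep (L : Type) e₁ (frameD V) (frameD_real V) (frameD_ne V) (lineVec (L : Type) (dW S 0)) (fun _ => dW_real S 0)
            (fun _ => dW_ne S 0) hGR₀
            (UnitaryGroup.archSingle (↥(maximalRealSubfield L)) L (IsCMField.complexConj L) 3 (Matrix.diagonal (frameD V))
              (IsCMField.complexConj_ne_one L) (NumberField.complexConj_smul_infinitePlace (L : Type)) (cmPlaceOver (L : Type) b) u, 1)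
            (blockFamilyOfAt (L : Type) e₁ (frameD V) (frameD_real V) (frameD_ne V) (lineVec (L : Type) (dW S 0)) (fun _ => dW_real S 0)
              (fun _ => dW_ne S 0) ι₁ (blockPosEquiv V) (blockNegEquiv V) eR eS (degOnePDual S') (binvPi 1) ℓ) =
          (((u : UnitaryGroup.archLocal (L : Type) 3 (Matrix.diagonal (frameD V)) (cmPlaceOver (L : Type) b)) : GL (Fin 3) ℂ) :
              Matrix (Fin 3) (Fin 3) ℂ).det ^ a b •
            blockFamilyOfAt (L : Type) e₁ (frameD V) (frameD_real V) (frameD_ne V) (lineVec (L : Type) (dW S 0)) (fun _ => dW_real S 0)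
              (fun _ => dW_ne S 0) ι₁ (blockPosEquiv V) (blockNegEquiv V) eR eS (degOnePDual S') (binvPi 1) ℓ)
    (hdef : ∀ b : {v : InfinitePlace ↥(maximalRealSubfield L) // v.IsReal}, b ≠ HypCensus.cmPlace (L : Type) ι₁ →
      ∀ u : UnitaryGroup.archLocal (L : Type) 3 (Matrix.diagonal (frameD V)) (cmPlaceOver (L : Type) b),
        ((archScalar_zeroG V S hGR hGR₀ hGR₁ η₀
            (UnitaryGroup.archSingle (↥(maximalRealSubfield L)) L (IsCMField.complexConj L) 3 (Matrix.diagonal (frameD V))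
              (IsCMField.complexConj_ne_one L) (NumberField.complexConj_smul_infinitePlace (L : Type)) (cmPlaceOver (L : Type) b) u) : ℂˣ) : ℂ) *
          (((u : UnitaryGroup.archLocal (L : Type) 3 (Matrix.diagonal (frameD V)) (cmPlaceOver (L : Type) b)) : GL (Fin 3) ℂ) :
              Matrix (Fin 3) (Fin 3) ℂ).det ^ a b = 1) :
    ∀ aa : UnitaryGroup.arch (↥(maximalRealSubfield L)) L (IsCMField.complexConj L) 3 V.Hm,
      UnitaryGroup.archAt (↥(maximalRealSubfield L)) L (IsCMField.complexConj L) 3 V.Hm (UnitaryGroup.cmPlace (L : Type) ι₁)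
          (NumberField.complexConj_smul_infinitePlace (L : Type) _) (IsCMField.complexConj_ne_one (L : Type)) aa = 1 →
      ∀ (ℓ : Module.Dual ℂ (Fin 2 → ℂ)) (Φf : FinSB (↥(maximalRealSubfield L)) (Fin 3)),
        lineRepOf V S hGR hGR₀ hGR₁ hGR₂ hGR₃ η₀ η₁ η₂ η₃ 0
            (HodgeCM.Adelic.regimeEquiv L V.Hm hV
              (UnitaryGroup.archToAdelic (↥(maximalRealSubfield L)) L (IsCMField.complexConj L) 3 V.Hm aa), 1)
            (piSchwartzBruhatEquiv (↥(maximalRealSubfield L)) (Fin 3)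
              (blockFamilyOfAt (L : Type) e₁ (frameD V) (frameD_real V) (frameD_ne V) (lineVec (L : Type) (dW S 0)) (fun _ => dW_real S 0)
              (fun _ => dW_ne S 0) ι₁ (blockPosEquiv V) (blockNegEquiv V) eR eS (degOnePDual S') (binvPi 1) ℓ ⊗ₜ[ℂ] Φf)) =
          piSchwartzBruhatEquiv (↥(maximalRealSubfield L)) (Fin 3)
            (blockFamilyOfAt (L : Type) e₁ (frameD V) (frameD_real V) (frameD_ne V) (lineVec (L : Type) (dW S 0)) (fun _ => dW_real S 0)
              (fun _ => dW_ne S 0) ι₁ (blockPosEquiv V) (blockNegEquiv V) eR eS (degOnePDual S') (binvPi 1) ℓ ⊗ₜ[ℂ] Φf) := by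
  intro aa haa ℓ Φf
  rw [lineRepOf_zero_regime_archToAdelicG V S hGR hGR₀ hGR₁ hGR₂ hGR₃ η₀ η₁ η₂ η₃ hV aa, adelicTensorEnd_apply_tmul, LinearMap.smul_apply,
    LinearMap.id_apply, smul_cmArchWeilRep_blockFamilyOfAt_eq_self_zeroG (V := V) (S := S) (hGR := hGR) (hGR₀ := hGR₀) (hGR₁ := hGR₁)
      (η₀ := η₀) (eR := eR) (eS := eS) (a := a) (hω := hω) (hdef := hdef) aa haa ℓ]

/-- **(c5) for line 1, ARCHIMEDEAN CORE**. -/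
theorem smul_cmArchWeilRep_blockFamilyOfAt_eq_self_oneG
    (a : {v : InfinitePlace ↥(maximalRealSubfield L) // v.IsReal} → ℤ)
    (hω : ∀ b : {v : InfinitePlace ↥(maximalRealSubfield L) // v.IsReal}, b ≠ HypCensus.cmPlace (L : Type) ι₁ →
      ∀ (u : UnitaryGroup.archLocal (L : Type) 3 (Matrix.diagonal (frameD V)) (cmPlaceOver (L : Type) b)) (ℓ : Module.Dual ℂ (Fin 2 → ℂ)),
        cmArchWeilRep (L : Type) e₁ (frameD V) (frameD_real V) (frameD_ne V) (lineVec (L : Type) (dW S 1)) (fun _ => dW_real S 1)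
            (fun _ => dW_ne S 1) hGR₁
            (UnitaryGroup.archSingle (↥(maximalRealSubfield L)) L (IsCMField.complexConj L) 3 (Matrix.diagonal (frameD V))
              (IsCMField.complexConj_ne_one L) (NumberField.complexConj_smul_infinitePlace (L : Type)) (cmPlaceOver (L : Type) b) u, 1)
            (blockFamilyOfAt (L : Type) e₁ (frameD V) (frameD_real V) (frameD_ne V) (lineVec (L : Type) (dW S 1)) (fun _ => dW_real S 1)
              (fun _ => dW_ne S 1) ι₁ (blockPosEquiv V) (blockNegEquiv V) eR₁ eS₁ (degOnePDual S') (binvPi 1) ℓ) =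
          (((u : UnitaryGroup.archLocal (L : Type) 3 (Matrix.diagonal (frameD V)) (cmPlaceOver (L : Type) b)) : GL (Fin 3) ℂ) :
              Matrix (Fin 3) (Fin 3) ℂ).det ^ a b •
            blockFamilyOfAt (L : Type) e₁ (frameD V) (frameD_real V) (frameD_ne V) (lineVec (L : Type) (dW S 1)) (fun _ => dW_real S 1)
              (fun _ => dW_ne S 1) ι₁ (blockPosEquiv V) (blockNegEquiv V) eR₁ eS₁ (degOnePDual S') (binvPi 1) ℓ)
    (hdef : ∀ b : {v : InfinitePlace ↥(maximalRealSubfield L) // v.IsReal}, b ≠ HypCensus.cmPlace (L : Type) ι₁ →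
      ∀ u : UnitaryGroup.archLocal (L : Type) 3 (Matrix.diagonal (frameD V)) (cmPlaceOver (L : Type) b),
        ((archScalar_oneG V S hGR hGR₀ hGR₁ η₁
            (UnitaryGroup.archSingle (↥(maximalRealSubfield L)) L (IsCMField.complexConj L) 3 (Matrix.diagonal (frameD V))
              (IsCMField.complexConj_ne_one L) (NumberField.complexConj_smul_infinitePlace (L : Type)) (cmPlaceOver (L : Type) b) u) : ℂˣ) : ℂ) *
          (((u : UnitaryGroup.archLocal (L : Type) 3 (Matrix.diagonal (frameD V)) (cmPlaceOver (L : Type) b)) : GL (Fin 3) ℂ) :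
              Matrix (Fin 3) (Fin 3) ℂ).det ^ a b = 1) :
    ∀ aa : UnitaryGroup.arch (↥(maximalRealSubfield L)) L (IsCMField.complexConj L) 3 V.Hm,
      UnitaryGroup.archAt (↥(maximalRealSubfield L)) L (IsCMField.complexConj L) 3 V.Hm (UnitaryGroup.cmPlace (L : Type) ι₁)
          (NumberField.complexConj_smul_infinitePlace (L : Type) _) (IsCMField.complexConj_ne_one (L : Type)) aa = 1 →
      ∀ ℓ : Module.Dual ℂ (Fin 2 → ℂ),
        ((archScalar_oneG V S hGR hGR₀ hGR₁ η₁ (archFrameCongr (L : Type) V.Hm (frameG V) (frameD V) (frame_congr V) aa) : ℂˣ) : ℂ) •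
            cmArchWeilRep (L : Type) e₁ (frameD V) (frameD_real V) (frameD_ne V) (lineVec (L : Type) (dW S 1)) (fun _ => dW_real S 1)
              (fun _ => dW_ne S 1) hGR₁ (archFrameCongr (L : Type) V.Hm (frameG V) (frameD V) (frame_congr V) aa, 1)
              (blockFamilyOfAt (L : Type) e₁ (frameD V) (frameD_real V) (frameD_ne V) (lineVec (L : Type) (dW S 1)) (fun _ => dW_real S 1)
              (fun _ => dW_ne S 1) ι₁ (blockPosEquiv V) (blockNegEquiv V) eR₁ eS₁ (degOnePDual S') (binvPi 1) ℓ) =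
          blockFamilyOfAt (L : Type) e₁ (frameD V) (frameD_real V) (frameD_ne V) (lineVec (L : Type) (dW S 1)) (fun _ => dW_real S 1)
              (fun _ => dW_ne S 1) ι₁ (blockPosEquiv V) (blockNegEquiv V) eR₁ eS₁ (degOnePDual S') (binvPi 1) ℓ := by
  intro aa haa ℓ
  have h := smul_apply_eq_self_of_places (L : Type) (Matrix.diagonal (frameD V))
    ((cmArchWeilRep (L : Type) e₁ (frameD V) (frameD_real V) (frameD_ne V) (lineVec (L : Type) (dW S 1)) (fun _ => dW_real S 1)
      (fun _ => dW_ne S 1) hGR₁).comp (MonoidHom.inl _ _))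
    (archScalar_oneG V S hGR hGR₀ hGR₁ η₁)
    (blockFamilyOfAt (L : Type) e₁ (frameD V) (frameD_real V) (frameD_ne V) (lineVec (L : Type) (dW S 1)) (fun _ => dW_real S 1)
      (fun _ => dW_ne S 1) ι₁ (blockPosEquiv V) (blockNegEquiv V) eR₁ eS₁ (degOnePDual S') (binvPi 1) ℓ)
    (UnitaryGroup.cmPlace (L : Type) ι₁) (fun b hb u => by
      rw [MonoidHom.comp_apply, MonoidHom.inl_apply, hω b (ne_cmPlace_of_cmPlaceOver_ne hb) u ℓ, smul_smul,
        hdef b (ne_cmPlace_of_cmPlaceOver_ne hb) u, one_smul])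
    (archFrameCongr (L : Type) V.Hm (frameG V) (frameD V) (frame_congr V) aa) (archAt_archFrameCongr_eq_one V haa)
  rw [MonoidHom.comp_apply, MonoidHom.inl_apply] at h
  exact h

/-- **(c5) for line 1 AT THE OPERATOR LEVEL, FOR EVERY FINITE VECTOR** — sinst-1's `ThetaDistDatum.hdef` for slot 1 at `lineRepOf`. -/
theorem harch_one_of_defType_tmulG
    (a : {v : InfinitePlace ↥(maximalRealSubfield L) // v.IsReal} → ℤ)
    (hω : ∀ b : {v : InfinitePlace ↥(maximalRealSubfield L) // v.IsReal}, b ≠ HypCensus.cmPlace (L : Type) ι₁ →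
      ∀ (u : UnitaryGroup.archLocal (L : Type) 3 (Matrix.diagonal (frameD V)) (cmPlaceOver (L : Type) b)) (ℓ : Module.Dual ℂ (Fin 2 → ℂ)),
        cmArchWeilRep (L : Type) e₁ (frameD V) (frameD_real V) (frameD_ne V) (lineVec (L : Type) (dW S 1)) (fun _ => dW_real S 1)
            (fun _ => dW_ne S 1) hGR₁
            (UnitaryGroup.archSingle (↥(maximalRealSubfield L)) L (IsCMField.complexConj L) 3 (Matrix.diagonal (frameD V))
              (IsCMField.complexConj_ne_one L) (NumberField.complexConj_smul_infinitePlace (L : Type)) (cmPlaceOver (L : Type) b) u, 1)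
            (blockFamilyOfAt (L : Type) e₁ (frameD V) (frameD_real V) (frameD_ne V) (lineVec (L : Type) (dW S 1)) (fun _ => dW_real S 1)
              (fun _ => dW_ne S 1) ι₁ (blockPosEquiv V) (blockNegEquiv V) eR₁ eS₁ (degOnePDual S') (binvPi 1) ℓ) =
          (((u : UnitaryGroup.archLocal (L : Type) 3 (Matrix.diagonal (frameD V)) (cmPlaceOver (L : Type) b)) : GL (Fin 3) ℂ) :
              Matrix (Fin 3) (Fin 3) ℂ).det ^ a b •
            blockFamilyOfAt (L : Type) e₁ (frameD V) (frameD_real V) (frameD_ne V) (lineVec (L : Type) (dW S 1)) (fun _ => dW_real S 1)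
              (fun _ => dW_ne S 1) ι₁ (blockPosEquiv V) (blockNegEquiv V) eR₁ eS₁ (degOnePDual S') (binvPi 1) ℓ)
    (hdef : ∀ b : {v : InfinitePlace ↥(maximalRealSubfield L) // v.IsReal}, b ≠ HypCensus.cmPlace (L : Type) ι₁ →
      ∀ u : UnitaryGroup.archLocal (L : Type) 3 (Matrix.diagonal (frameD V)) (cmPlaceOver (L : Type) b),
        ((archScalar_oneG V S hGR hGR₀ hGR₁ η₁
            (UnitaryGroup.archSingle (↥(maximalRealSubfield L)) L (IsCMField.complexConj L) 3 (Matrix.diagonal (frameD V))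
              (IsCMField.complexConj_ne_one L) (NumberField.complexConj_smul_infinitePlace (L : Type)) (cmPlaceOver (L : Type) b) u) : ℂˣ) : ℂ) *
          (((u : UnitaryGroup.archLocal (L : Type) 3 (Matrix.diagonal (frameD V)) (cmPlaceOver (L : Type) b)) : GL (Fin 3) ℂ) :
              Matrix (Fin 3) (Fin 3) ℂ).det ^ a b = 1) :
    ∀ aa : UnitaryGroup.arch (↥(maximalRealSubfield L)) L (IsCMField.complexConj L) 3 V.Hm,
      UnitaryGroup.archAt (↥(maximalRealSubfield L)) L (IsCMField.complexConj L) 3 V.Hm (UnitaryGroup.cmPlace (L : Type) ι₁)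
          (NumberField.complexConj_smul_infinitePlace (L : Type) _) (IsCMField.complexConj_ne_one (L : Type)) aa = 1 →
      ∀ (ℓ : Module.Dual ℂ (Fin 2 → ℂ)) (Φf : FinSB (↥(maximalRealSubfield L)) (Fin 3)),
        lineRepOf V S hGR hGR₀ hGR₁ hGR₂ hGR₃ η₀ η₁ η₂ η₃ 1
            (HodgeCM.Adelic.regimeEquiv L V.Hm hV
              (UnitaryGroup.archToAdelic (↥(maximalRealSubfield L)) L (IsCMField.complexConj L) 3 V.Hm aa), 1)
            (piSchwartzBruhatEquiv (↥(maximalRealSubfield L)) (Fin 3)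
              (blockFamilyOfAt (L : Type) e₁ (frameD V) (frameD_real V) (frameD_ne V) (lineVec (L : Type) (dW S 1)) (fun _ => dW_real S 1)
              (fun _ => dW_ne S 1) ι₁ (blockPosEquiv V) (blockNegEquiv V) eR₁ eS₁ (degOnePDual S') (binvPi 1) ℓ ⊗ₜ[ℂ] Φf)) =
          piSchwartzBruhatEquiv (↥(maximalRealSubfield L)) (Fin 3)
            (blockFamilyOfAt (L : Type) e₁ (frameD V) (frameD_real V) (frameD_ne V) (lineVec (L : Type) (dW S 1)) (fun _ => dW_real S 1)
              (fun _ => dW_ne S 1) ι₁ (blockPosEquiv V) (blockNegEquiv V) eR₁ eS₁ (degOnePDual S') (binvPi 1) ℓ ⊗ₜ[ℂ] Φf) := by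
  intro aa haa ℓ Φf
  rw [lineRepOf_one_regime_archToAdelicG V S hGR hGR₀ hGR₁ hGR₂ hGR₃ η₀ η₁ η₂ η₃ hV aa, adelicTensorEnd_apply_tmul, LinearMap.smul_apply,
    LinearMap.id_apply, smul_cmArchWeilRep_blockFamilyOfAt_eq_self_oneG (V := V) (S := S) (hGR := hGR) (hGR₀ := hGR₀) (hGR₁ := hGR₁)
      (η₁ := η₁) (eR₁ := eR₁) (eS₁ := eS₁) (a := a) (hω := hω) (hdef := hdef) aa haa ℓ]

end DefTypeTmul

/-! ### § 2. (W-K∞′) for the honest archimedean factors `lineOmega_zero/one` on the slot family, pin-discharged -/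

section Harm

variable {L : CMField} {ι₁ : L →+* ℂ} (V : HermSpace3 L ι₁) (c : SeesawCtx L)
variable
  (hGR : (cmSplittingDatum (L : Type) finProdFinEquiv (frameD V) (frameD_real V) (frameD_ne V) (dW c.D) (dW_real c.D)
    (dW_ne c.D)).CompatibleSplitting)
  (hGR₀ : (cmSplittingDatum (L : Type) (e₁) (frameD V) (frameD_real V) (frameD_ne V) (lineVec (L : Type) (dW c.D 0))
    (fun _ => dW_real c.D 0) (fun _ => dW_ne c.D 0)).CompatibleSplitting)
  (hGR₁ : (cmSplittingDatum (L : Type) (e₁) (frameD V) (frameD_real V) (frameD_ne V) (lineVec (L : Type) (dW c.D 1))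
    (fun _ => dW_real c.D 1) (fun _ => dW_ne c.D 1)).CompatibleSplitting)
  (η₀ η₁ : CMAdelic (L : Type) (frameD V) × CMAdelicOne (L : Type) →* ℂˣ)
  (h₁W : (∀ j, 0 < (ι₁ (dW c.D j)).re) ∨ ∀ j, (ι₁ (dW c.D j)).re < 0)
  (Φ₂ : SchwartzMap ((Fin 3 × {v : {v : InfinitePlace ↥(maximalRealSubfield L) // v.IsReal} // v ≠ HypCensus.cmPlace (L : Type) ι₁}) → ℝ) ℂ)

/-- **(W-K∞′) for line 0 — `harm` of the (J4) datum at `lineOmega_zero`**: the `ι₁`-archimedean factor acts on the slot family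
`ℓ ↦ blockFamilyOfAt … eR eS (degOnePDual Empty) Φ₂ ℓ` through `τ₁^∨ = (weightOf x₀)^∨` on `Stab(x₀)`; #CA13 `smulPull_blockFamilyOfAt_harm` with
`hsec` (canonical representative `hemb`), `(K)` (#CA14, exponent tuple of record) and `hΦ₁` discharged — the one input left is (χ)₀ `hχ`. -/
theorem harm_lineOmega_zeroG (hemb : (InfinitePlace.mk ι₁).embedding = ι₁)
    (eR : PosIdx (cmXW (L : Type) (frameD V) (lineVec (L : Type) (dW c.D 0)) (fun _ => dW_real c.D 0) ι₁ (HypCensus.cmPlace (L : Type) ι₁)) ≃ Unit)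
    (eS : NegIdx (cmXW (L : Type) (frameD V) (lineVec (L : Type) (dW c.D 0)) (fun _ => dW_real c.D 0) ι₁ (HypCensus.cmPlace (L : Type) ι₁)) ≃ Empty)
    (hχ : ∀ u : stabilizer U21 x₀,
      ((lineScalar_zero V c.D hGR hGR₀ hGR₁ η₀ (u : U21) : ℂˣ) : ℂ) *
          ((matA (stabilizerEquivK21.symm u)).det ^ (lineVacExponentsZero V c hGR₀ h₁W eR eS).eP *
            sclD (stabilizerEquivK21.symm u) ^ (lineVacExponentsZero V c hGR₀ h₁W eR eS).eQ) =
        star (sclD (stabilizerEquivK21.symm u)))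
    (u : stabilizer U21 x₀) (ℓ : Module.Dual ℂ (Fin 2 → ℂ)) :
    lineOmega_zero V c.D hGR hGR₀ hGR₁ η₀ (u : U21)
        (blockFamilyOfAt (L : Type) e₁ (frameD V) (frameD_real V) (frameD_ne V) (lineVec (L : Type) (dW c.D 0)) (fun _ => dW_real c.D 0)
          (fun _ => dW_ne c.D 0) ι₁ (blockPosEquiv V) (blockNegEquiv V) eR eS (degOnePDual Empty) Φ₂ ℓ) =
      blockFamilyOfAt (L : Type) e₁ (frameD V) (frameD_real V) (frameD_ne V) (lineVec (L : Type) (dW c.D 0)) (fun _ => dW_real c.D 0)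
        (fun _ => dW_ne c.D 0) ι₁ (blockPosEquiv V) (blockNegEquiv V) eR eS (degOnePDual Empty) Φ₂
        ((isPullbackCocycle_cotangentCocycle.weightOf x₀).dual u ℓ) :=
  smulPull_blockFamilyOfAt_harm V e₁ (lineVec (L : Type) (dW c.D 0)) (fun _ => dW_real c.D 0) (fun _ => dW_ne c.D 0) hGR₀
    (lineScalar_zero V c.D hGR hGR₀ hGR₁ η₀) eR eS (degOnePDual Empty) Φ₂
    (hsec_of_embedding_eq V (lineVec (L : Type) (dW c.D 0)) (fun _ => dW_real c.D 0) (fun _ => dW_ne c.D 0) _ _ hemb)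
    (fun kk Φ => cmBlockRepAt_κ_tensorPi_lineVacExponentsZero V c hGR₀ h₁W eR eS kk Φ Φ₂)
    (unitaryOpPi_dualPairι_degOnePDual Empty) hχ u ℓ

/-- **(W-K∞′) for line 1 — `harm` of the (J4) datum at `lineOmega_one`**; the one input left is (χ)₁ `hχ`. -/
theorem harm_lineOmega_oneG (hemb : (InfinitePlace.mk ι₁).embedding = ι₁)
    (eR : PosIdx (cmXW (L : Type) (frameD V) (lineVec (L : Type) (dW c.D 1)) (fun _ => dW_real c.D 1) ι₁ (HypCensus.cmPlace (L : Type) ι₁)) ≃ Unit)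
    (eS : NegIdx (cmXW (L : Type) (frameD V) (lineVec (L : Type) (dW c.D 1)) (fun _ => dW_real c.D 1) ι₁ (HypCensus.cmPlace (L : Type) ι₁)) ≃ Empty)
    (hχ : ∀ u : stabilizer U21 x₀,
      ((lineScalar_one V c.D hGR hGR₀ hGR₁ η₁ (u : U21) : ℂˣ) : ℂ) *
          ((matA (stabilizerEquivK21.symm u)).det ^ (lineVacExponentsOne V c hGR₁ h₁W eR eS).eP *
            sclD (stabilizerEquivK21.symm u) ^ (lineVacExponentsOne V c hGR₁ h₁W eR eS).eQ) =
        star (sclD (stabilizerEquivK21.symm u)))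
    (u : stabilizer U21 x₀) (ℓ : Module.Dual ℂ (Fin 2 → ℂ)) :
    lineOmega_one V c.D hGR hGR₀ hGR₁ η₁ (u : U21)
        (blockFamilyOfAt (L : Type) e₁ (frameD V) (frameD_real V) (frameD_ne V) (lineVec (L : Type) (dW c.D 1)) (fun _ => dW_real c.D 1)
          (fun _ => dW_ne c.D 1) ι₁ (blockPosEquiv V) (blockNegEquiv V) eR eS (degOnePDual Empty) Φ₂ ℓ) =
      blockFamilyOfAt (L : Type) e₁ (frameD V) (frameD_real V) (frameD_ne V) (lineVec (L : Type) (dW c.D 1)) (fun _ => dW_real c.D 1)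
        (fun _ => dW_ne c.D 1) ι₁ (blockPosEquiv V) (blockNegEquiv V) eR eS (degOnePDual Empty) Φ₂
        ((isPullbackCocycle_cotangentCocycle.weightOf x₀).dual u ℓ) :=
  smulPull_blockFamilyOfAt_harm V e₁ (lineVec (L : Type) (dW c.D 1)) (fun _ => dW_real c.D 1) (fun _ => dW_ne c.D 1) hGR₁
    (lineScalar_one V c.D hGR hGR₀ hGR₁ η₁) eR eS (degOnePDual Empty) Φ₂
    (hsec_of_embedding_eq V (lineVec (L : Type) (dW c.D 1)) (fun _ => dW_real c.D 1) (fun _ => dW_ne c.D 1) _ _ hemb)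
    (fun kk Φ => cmBlockRepAt_κ_tensorPi_lineVacExponentsOne V c hGR₁ h₁W eR eS kk Φ Φ₂)
    (unitaryOpPi_dualPairι_degOnePDual Empty) hχ u ℓ

end Harm

end HodgeCM.Model

end
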